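import Summits.QuantumAdvantage.AdviceFreeQNC0.AffBells22FrameAveraging
import Summits.QuantumAdvantage.AdviceFreeQNC0.AffBells22FrameLinCommon
import Summits.QuantumAdvantage.AdviceFreeQNC0.AffBells23NearPerfect
import HarnessLib

/-!
# The frame side of the (NP₁) dichotomy: affine frame ⊗ junta strategies lose a constant fraction (planner qa-qnc0-p1 g27, ROUND-26 §4, S-27F)

Support for crux `RingDenseResidualLt3` (stmt-QuantumAdvantage-22907), route `DWalkThree`.  An affine MOD₃ bell strategy `(β, c)` whose rows
decompose as `β_k = a_k · V + r_k` over a frame `V` of bounded dimension whose non-zero combinations have weight ≥ δN, with `r_k` supported on an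
own exceptional set `T_k` of at most `w₀` positions, IS a frame ⊗ junta strategy `frameJuntaBell V τ` of `AffBells22` (the table of bell `k`
reads the frame value and its own `≤ w₀` bits).  Hence the LANDED rung `AffBells22.ringFrameJuntaLt3` bounds its winning set by `θ·2^{N−1}`.

* `FrameJuntaDecomp L r₀ w₀ β` — the decomposition predicate (Sketch27 §27.3 verbatim);
* `affTable` — the junta table of the decomposition; `affTable_readsOnly`; `frameJuntaBell_affTable` (it reproduces `affBell β c`);
* **`affFrameJuntaLossLin : AffFrameJuntaLossLin`** — ∀ δ > 0, ∀ r₀ w₀, ∃ θ < 1, ∃ n₀, ∀ N ≥ n₀, ∀ β c, `FrameJuntaDecomp ⌈δN⌉ r₀ w₀ β →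
  affWinCard β c ≤ θ·2^{N−1}` (PROVED from `ringFrameJuntaLt3`).

* **`FrameDecompReg δ δ₀ r₀ w₀ β` / `affFrameLossReg : AffFrameLossReg`** — the same with, in addition, a COMMON JUNTA `J₀` of LINEAR size
  `|J₀| ≤ δ₀N` (`δ₀ < 1/2`) on which the rows are arbitrary and regularity required only off `J₀` (PROVED from the landed
  `AffBells22.ringFrameJuntaLinCommonLt3`).  This covers every sparse / irregular frame direction of weight `< N/2` (put its support into `J₀`).
* `FrameDecomp δ₀ r₀ w₀ β` (NO regularity hypothesis: up to own `w₀`-sparse corrections and a common junta of size `≤ δ₀N`, the rows lie in a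
  common space of dimension `< r₀`) and **`affFrameLoss : AffFrameLoss` PROVED** via `frameRegularization : AffFrameLossReg → AffFrameLoss`
  (iteratively move the off-`J₀` support of a light frame combination into `J₀` and drop one frame dimension; `≤ r₀` rounds, `J₀` grows by `≤ r₀·δN`).
  THIS IS THE WHOLE FRAME SIDE OF THE DICHOTOMY: the only open statement of the (NP₁) plan is now the window side `HWFar₀` (Sketch27 §27.4).

WHAT THIS IS NOT: not the far-from-frame side (`HWFar₀`, windows: planner Sketch27 §27.4), nothing about the crux itself.
-/

namespace Summit.QuantumAdvantage.AdviceFreeQNC0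

open Finset Literature.Computability.QuantumComplexity Literature.Computability.QuantumComplexity.RingHLF
open AffBells22 AffBells23

namespace AffBells27

/-- `β` is FRAME ⊗ JUNTA DECOMPOSABLE with regularity `L`, frame dimension `< r₀` and junta width `w₀` (Sketch27 §27.3 verbatim). -/
def FrameJuntaDecomp {N : ℕ} (L r₀ w₀ : ℕ) (β : Fin N → Fin N → ZMod 3) : Prop :=
  ∃ m : ℕ, m < r₀ ∧ ∃ (V : Fin m → Fin N → ZMod 3) (a : Fin N → Fin m → ZMod 3) (T : Fin N → Finset (Fin N)),
    (∀ t : Fin m → ZMod 3, t ≠ 0 → L ≤ (univ.filter fun i : Fin N => (∑ l, t l * V l i) ≠ 0).card) ∧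
    (∀ k, (T k).card ≤ w₀) ∧ (∀ k i, i ∉ T k → β k i = ∑ l, a k l * V l i)

/-- **(F-lin)** (Sketch27 §27.3 verbatim). -/
def AffFrameJuntaLossLin : Prop :=
  ∀ δ : ℝ, 0 < δ → ∀ r₀ w₀ : ℕ, ∃ θ : ℝ, θ < 1 ∧ ∃ n₀ : ℕ, ∀ N ≥ n₀, ∀ (β : Fin N → Fin N → ZMod 3) (c : Fin N → ZMod 3),
    FrameJuntaDecomp (Nat.ceil (δ * N)) r₀ w₀ β → (affWinCard β c : ℝ) ≤ θ * (2 : ℝ) ^ (N - 1)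

/-- The junta table of a decomposed affine bell: `τ_k(u, x) = [Σ_l a_kl u_l + Σ_{i ∈ T_k} (β_ki − (a_k V)_i)·x_i = c_k]`. -/
def affTable {N m : ℕ} (β : Fin N → Fin N → ZMod 3) (c : Fin N → ZMod 3) (V : Fin m → Fin N → ZMod 3)
    (a : Fin N → Fin m → ZMod 3) (T : Fin N → Finset (Fin N)) (k : Fin N) (u : Fin m → ZMod 3) (x : Fin N → Bool) : Bool :=
  decide ((∑ l, a k l * u l) + (∑ i ∈ T k, if x i then β k i - ∑ l, a k l * V l i else 0) = c k)

/-- The affine table reads only its own junta columns. -/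
theorem affTable_readsOnly {N m : ℕ} (β : Fin N → Fin N → ZMod 3) (c : Fin N → ZMod 3) (V : Fin m → Fin N → ZMod 3)
    (a : Fin N → Fin m → ZMod 3) (T : Fin N → Finset (Fin N)) (k : Fin N) (u : Fin m → ZMod 3) :
    ReadsOnly (T k) (affTable β c V a T k u) := by
  intro x x' h
  unfold affTable
  have : (∑ i ∈ T k, if x i then β k i - ∑ l, a k l * V l i else 0)
      = ∑ i ∈ T k, if x' i then β k i - ∑ l, a k l * V l i else 0 :=
    Finset.sum_congr rfl fun i hi => by rw [h i hi]
  rw [this]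

/-- The decomposed table reproduces the affine bell. -/
theorem frameJuntaBell_affTable {N m : ℕ} (β : Fin N → Fin N → ZMod 3) (c : Fin N → ZMod 3) (V : Fin m → Fin N → ZMod 3)
    (a : Fin N → Fin m → ZMod 3) (T : Fin N → Finset (Fin N)) (hβ : ∀ k i, i ∉ T k → β k i = ∑ l, a k l * V l i) :
    frameJuntaBell V (affTable β c V a T) = affBell β c := by
  funext x k
  unfold frameJuntaBell affTable affBell frameVal
  congr 1
  apply propext
  -- both sides: (expression) = c k; show the expressions agree
  have key : (∑ l, a k l * ∑ i : Fin N, (if x i then V l i else 0))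
      + (∑ i ∈ T k, if x i then β k i - ∑ l, a k l * V l i else 0)
      = ∑ i : Fin N, if x i then β k i else 0 := by
    -- rewrite the frame part as a sum over i
    have h1 : (∑ l, a k l * ∑ i : Fin N, (if x i then V l i else 0))
        = ∑ i : Fin N, if x i then ∑ l, a k l * V l i else 0 := by
      calc (∑ l, a k l * ∑ i : Fin N, (if x i then V l i else 0))
          = ∑ l, ∑ i : Fin N, a k l * (if x i then V l i else 0) := by simp_rw [Finset.mul_sum]
        _ = ∑ i : Fin N, ∑ l, a k l * (if x i then V l i else 0) := Finset.sum_comm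
        _ = ∑ i : Fin N, if x i then ∑ l, a k l * V l i else 0 := by
            refine Finset.sum_congr rfl fun i _ => ?_
            by_cases hx : x i <;> simp [hx]
    -- the exceptional part as a sum over all i (zero off T k, by hβ)
    have h2 : (∑ i ∈ T k, if x i then β k i - ∑ l, a k l * V l i else 0)
        = ∑ i : Fin N, if x i then β k i - ∑ l, a k l * V l i else 0 := by
      apply Finset.sum_subset (Finset.subset_univ _)
      intro i _ hi
      by_cases hx : x i
      · simp [hx, hβ k i hi]
      · simp [hx]
    rw [h1, h2, ← Finset.sum_add_distrib]
    refine Finset.sum_congr rfl fun i _ => ?_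
    by_cases hx : x i <;> simp [hx]
  constructor
  · intro h; rw [← key]; exact h
  · intro h; rw [key]; exact h

/-- **(F-lin) PROVED:** decomposable affine strategies over a `δN`-regular frame of bounded dimension lose a constant fraction
(`AffBells22.ringFrameJuntaLt3`). -/
theorem affFrameJuntaLossLin : AffFrameJuntaLossLin := by
  intro δ hδ r₀ w₀
  obtain ⟨μ₀, hμ₀, θ, hθ, n₀, hn₀⟩ := ringFrameJuntaLt3 δ hδ w₀
  obtain ⟨M, hM⟩ := exists_nat_gt ((r₀ : ℝ) / μ₀)
  refine ⟨θ, hθ, max n₀ M, fun N hN β c hdec => ?_⟩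
  obtain ⟨m, hm, V, a, T, hreg, hT, hβ⟩ := hdec
  have hNn₀ : n₀ ≤ N := le_of_max_le_left hN
  have hNM : (M : ℝ) ≤ N := by exact_mod_cast le_of_max_le_right hN
  have hmμ : (m : ℝ) ≤ μ₀ * N := by
    have h1 : (m : ℝ) ≤ r₀ := by exact_mod_cast hm.le
    have h2 : (r₀ : ℝ) < μ₀ * M := by
      have := (div_lt_iff₀ hμ₀).mp hM
      linarith [this]
    have h3 : μ₀ * (M : ℝ) ≤ μ₀ * N := mul_le_mul_of_nonneg_left hNM hμ₀.le
    linarith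
  have hreg' : ∀ t : Fin m → ZMod 3, t ≠ 0 →
      δ * N ≤ ((univ.filter fun i : Fin N => (∑ l : Fin m, t l * V l i) ≠ 0).card : ℝ) := by
    intro t ht
    have h := hreg t ht
    have hc : δ * N ≤ (Nat.ceil (δ * N) : ℝ) := Nat.le_ceil _
    exact hc.trans (by exact_mod_cast h)
  have hwin := hn₀ N hNn₀ m hmμ V T (affTable β c V a T) hreg' hT (fun k y => affTable_readsOnly β c V a T k y)
  have heq : winCount (frameJuntaBell V (affTable β c V a T)) = affWinCard β c := by
    rw [frameJuntaBell_affTable β c V a T hβ]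
    rfl
  rw [heq] at hwin
  exact hwin

/-! ### Common junta of linear size + regular frame off it (from `ringFrameJuntaLinCommonLt3`) -/

/-- Decomposition with a COMMON JUNTA `J₀` (`|J₀| ≤ δ₀N`, rows arbitrary there), own juntas `T_k` (`≤ w₀`), and a frame of dimension `< r₀`
that is `δN`-regular OFF `J₀`. -/
def FrameDecompReg {N : ℕ} (δ δ₀ : ℝ) (r₀ w₀ : ℕ) (β : Fin N → Fin N → ZMod 3) : Prop :=
  ∃ m : ℕ, m < r₀ ∧ ∃ (V : Fin m → Fin N → ZMod 3) (a : Fin N → Fin m → ZMod 3) (J₀ : Finset (Fin N)) (T : Fin N → Finset (Fin N)),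
    ((J₀.card : ℝ) ≤ δ₀ * N) ∧
    (∀ t : Fin m → ZMod 3, t ≠ 0 → δ * N ≤ ((univ.filter fun i : Fin N => i ∉ J₀ ∧ (∑ l, t l * V l i) ≠ 0).card : ℝ)) ∧
    (∀ k, (T k).card ≤ w₀) ∧ (∀ k i, i ∉ T k ∪ J₀ → β k i = ∑ l, a k l * V l i)

/-- **(F-reg)**: regular-off-a-linear-common-junta decompositions lose a constant fraction. -/
def AffFrameLossReg : Prop :=
  ∀ δ : ℝ, 0 < δ → ∀ δ₀ : ℝ, δ₀ < 1 / 2 → ∀ r₀ w₀ : ℕ, ∃ θ : ℝ, θ < 1 ∧ ∃ n₀ : ℕ, ∀ N ≥ n₀,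
    ∀ (β : Fin N → Fin N → ZMod 3) (c : Fin N → ZMod 3), FrameDecompReg δ δ₀ r₀ w₀ β → (affWinCard β c : ℝ) ≤ θ * (2 : ℝ) ^ (N - 1)

/-- Decomposition WITHOUT any regularity hypothesis: up to own `w₀`-sparse corrections and a common junta of size `≤ δ₀N`, the rows of `β` lie
in a common space of dimension `< r₀`. -/
def FrameDecomp {N : ℕ} (δ₀ : ℝ) (r₀ w₀ : ℕ) (β : Fin N → Fin N → ZMod 3) : Prop :=
  ∃ m : ℕ, m < r₀ ∧ ∃ (V : Fin m → Fin N → ZMod 3) (a : Fin N → Fin m → ZMod 3) (J₀ : Finset (Fin N)) (T : Fin N → Finset (Fin N)),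
    ((J₀.card : ℝ) ≤ δ₀ * N) ∧ (∀ k, (T k).card ≤ w₀) ∧ (∀ k i, i ∉ T k ∪ J₀ → β k i = ∑ l, a k l * V l i)

/-- **(F) — the frame-side TARGET of the dichotomy**: every decomposable strategy loses a constant fraction. -/
def AffFrameLoss : Prop :=
  ∀ δ₀ : ℝ, δ₀ < 1 / 2 → ∀ r₀ w₀ : ℕ, ∃ θ : ℝ, θ < 1 ∧ ∃ n₀ : ℕ, ∀ N ≥ n₀,
    ∀ (β : Fin N → Fin N → ZMod 3) (c : Fin N → ZMod 3), FrameDecomp δ₀ r₀ w₀ β → (affWinCard β c : ℝ) ≤ θ * (2 : ℝ) ^ (N - 1)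

/-- **Regularization** (support; PROVED below as `frameRegularization`): `AffFrameLossReg → AffFrameLoss`.  Pencil: given `FrameDecomp δ₀ r₀ w₀ β`
with frame `V` of dimension `m < r₀`, put `δ := (1/2 − δ₀)/(2 r₀ + 1)`; while some non-zero combination `tV` has `< δN` non-zero entries off `J₀`,
add those positions to `J₀` and replace `V` by a basis of `span V / ⟨tV⟩` (the coefficient of `tV` in each row moves into the `J₀`-part) — at most
`m` rounds, after which `|J₀| ≤ (δ₀ + r₀δ)N < N/2` and the remaining frame is `δN`-regular off `J₀`, i.e. `FrameDecompReg δ (δ₀ + r₀δ) r₀ w₀ β`;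
`θ :=` the `AffFrameLossReg` constant for these parameters. -/
def FrameRegularization : Prop := AffFrameLossReg → AffFrameLoss

/-- **(F-reg) PROVED** from `AffBells22.ringFrameJuntaLinCommonLt3`. -/
theorem affFrameLossReg : AffFrameLossReg := by
  intro δ hδ δ₀ hδ₀ r₀ w₀
  obtain ⟨μ₀, hμ₀, θ, hθ, n₀, hn₀⟩ := ringFrameJuntaLinCommonLt3 δ hδ δ₀ hδ₀ w₀
  obtain ⟨M, hM⟩ := exists_nat_gt ((r₀ : ℝ) / μ₀)
  refine ⟨θ, hθ, max n₀ M, fun N hN β c hdec => ?_⟩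
  obtain ⟨m, hm, V, a, J₀, T, hJ₀, hreg, hT, hβ⟩ := hdec
  have hNn₀ : n₀ ≤ N := le_of_max_le_left hN
  have hNM : (M : ℝ) ≤ N := by exact_mod_cast le_of_max_le_right hN
  have hmμ : (m : ℝ) ≤ μ₀ * N := by
    have h1 : (m : ℝ) ≤ r₀ := by exact_mod_cast hm.le
    have h2 : (r₀ : ℝ) < μ₀ * M := by
      have := (div_lt_iff₀ hμ₀).mp hM
      linarith [this]
    have h3 : μ₀ * (M : ℝ) ≤ μ₀ * N := mul_le_mul_of_nonneg_left hNM hμ₀.le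
    linarith
  have hβ' : ∀ k i, i ∉ (fun k => T k ∪ J₀) k → β k i = ∑ l, a k l * V l i := fun k i hi => hβ k i hi
  have hwin := hn₀ N hNn₀ m hmμ V J₀ T (affTable β c V a (fun k => T k ∪ J₀)) hJ₀ hreg hT
    (fun k y => affTable_readsOnly β c V a (fun k => T k ∪ J₀) k y)
  have heq : winCount (frameJuntaBell V (affTable β c V a (fun k => T k ∪ J₀))) = affWinCard β c := by
    rw [frameJuntaBell_affTable β c V a (fun k => T k ∪ J₀) hβ']
    rfl
  rw [heq] at hwin
  exact hwin

/-- `FrameDecompReg` ⇒ `FrameDecomp` (forget regularity) and `FrameJuntaDecomp L` ⇒ `FrameDecomp` (take `J₀ = ∅`): bookkeeping. -/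
theorem frameDecomp_of_reg {N : ℕ} {δ δ₀ : ℝ} {r₀ w₀ : ℕ} {β : Fin N → Fin N → ZMod 3}
    (h : FrameDecompReg δ δ₀ r₀ w₀ β) : FrameDecomp δ₀ r₀ w₀ β := by
  obtain ⟨m, hm, V, a, J₀, T, hJ₀, -, hT, hβ⟩ := h
  exact ⟨m, hm, V, a, J₀, T, hJ₀, hT, hβ⟩

/-- Bookkeeping: a frame-junta decomposition is a frame decomposition. -/
theorem frameDecomp_of_junta {N : ℕ} {L r₀ w₀ : ℕ} {δ₀ : ℝ} (hδ₀ : 0 ≤ δ₀) {β : Fin N → Fin N → ZMod 3}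
    (h : FrameJuntaDecomp L r₀ w₀ β) : FrameDecomp δ₀ r₀ w₀ β := by
  obtain ⟨m, hm, V, a, T, -, hT, hβ⟩ := h
  refine ⟨m, hm, V, a, ∅, T, by simp; positivity, hT, fun k i hi => hβ k i ?_⟩
  simpa using hi


/-! ### Regularization: `AffFrameLossReg → AffFrameLoss` -/

/-- In `ZMod 3` a non-zero element squares to `1`. -/
theorem zmod3_mul_self {u : ZMod 3} (hu : u ≠ 0) : u * u = 1 := by
  revert hu; decide +revert

/-- **Regularization PROVED**: iteratively absorb the support of a light frame combination into the common junta and drop a frame dimension. -/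
theorem frameRegularization : FrameRegularization := by
  intro hreg δ₀ hδ₀ r₀ w₀
  set δ : ℝ := (1 / 2 - δ₀) / (2 * ((r₀ : ℝ) + 1)) with hδdef
  have hr : (0 : ℝ) < (r₀ : ℝ) + 1 := by positivity
  have hδ : 0 < δ := by rw [hδdef]; apply div_pos <;> linarith
  have hδ₀' : δ₀ + r₀ * δ < 1 / 2 := by
    have h1 : (r₀ : ℝ) * δ ≤ ((r₀ : ℝ) + 1) * δ := by nlinarith
    have h2 : ((r₀ : ℝ) + 1) * δ = (1 / 2 - δ₀) / 2 := by rw [hδdef]; field_simp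
    linarith
  obtain ⟨θ, hθ, n₀, hn₀⟩ := hreg δ hδ (δ₀ + r₀ * δ) hδ₀' r₀ w₀
  refine ⟨θ, hθ, n₀, fun N hN β c hdec => ?_⟩
  have hNr : (0 : ℝ) ≤ N := by positivity
  -- the claim, by induction on the frame dimension `m`, with a common junta budget growing as `m` decreases
  have claim : ∀ m : ℕ, m < r₀ → ∀ (V : Fin m → Fin N → ZMod 3) (a : Fin N → Fin m → ZMod 3) (J₀ : Finset (Fin N))
      (T : Fin N → Finset (Fin N)),
      (J₀.card : ℝ) ≤ (δ₀ + ((r₀ : ℝ) - m) * δ) * N → (∀ k, (T k).card ≤ w₀) →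
      (∀ k i, i ∉ T k ∪ J₀ → β k i = ∑ l, a k l * V l i) → (affWinCard β c : ℝ) ≤ θ * (2 : ℝ) ^ (N - 1) := by
    intro m
    induction m with
    | zero =>
      intro hm V a J₀ T hJ hT hβ
      apply hn₀ N hN β c
      refine ⟨0, hm, V, a, J₀, T, ?_, ?_, hT, hβ⟩
      · refine hJ.trans ?_
        apply mul_le_mul_of_nonneg_right _ hNr
        simp
      · intro t ht
        exact absurd (Subsingleton.elim t 0) ht
    | succ m ih =>
      intro hm V a J₀ T hJ hT hβ
      by_cases hR : ∀ t : Fin (m + 1) → ZMod 3, t ≠ 0 →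
          δ * N ≤ ((univ.filter fun i : Fin N => i ∉ J₀ ∧ (∑ l, t l * V l i) ≠ 0).card : ℝ)
      · apply hn₀ N hN β c
        refine ⟨m + 1, hm, V, a, J₀, T, ?_, hR, hT, hβ⟩
        refine hJ.trans ?_
        apply mul_le_mul_of_nonneg_right _ hNr
        have : ((r₀ : ℝ) - (m + 1 : ℕ)) * δ ≤ r₀ * δ := by
          apply mul_le_mul_of_nonneg_right _ hδ.le
          push_cast
          linarith
        linarith
      · push Not at hR
        obtain ⟨t, ht, hlt⟩ := hR
        obtain ⟨l₀, hl₀⟩ : ∃ l₀, t l₀ ≠ 0 := by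
          by_contra h
          push Not at h
          exact ht (funext h)
        set S : Finset (Fin N) := univ.filter fun i : Fin N => i ∉ J₀ ∧ (∑ l, t l * V l i) ≠ 0 with hS
        have ht3 : t l₀ * t l₀ = 1 := zmod3_mul_self hl₀
        -- new data
        refine ih (Nat.lt_of_succ_lt hm) (fun j => V (l₀.succAbove j))
          (fun k j => a k (l₀.succAbove j) - a k l₀ * t l₀ * t (l₀.succAbove j)) (J₀ ∪ S) T ?_ hT ?_
        · -- junta budget
          have hcard : ((J₀ ∪ S).card : ℝ) ≤ J₀.card + S.card := by exact_mod_cast Finset.card_union_le J₀ S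
          have hm' : ((r₀ : ℝ) - m) * δ = ((r₀ : ℝ) - (m + 1 : ℕ)) * δ + δ := by push_cast; ring
          rw [hm']
          nlinarith [hJ, hlt.le, hcard]
        · intro k i hi
          simp only [Finset.mem_union, not_or] at hi
          obtain ⟨hiT, hiJ, hiS⟩ := hi
          have h1 : β k i = ∑ l, a k l * V l i := hβ k i (by simp [Finset.mem_union, hiT, hiJ])
          have h2 : (∑ l, t l * V l i) = 0 := by
            by_contra hne
            exact hiS (by rw [hS]; simp [hiJ, hne])
          rw [Fin.sum_univ_succAbove _ l₀] at h1 h2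
          have h4 : (∑ j : Fin m, (a k (l₀.succAbove j) - a k l₀ * t l₀ * t (l₀.succAbove j)) * V (l₀.succAbove j) i)
              = (∑ j : Fin m, a k (l₀.succAbove j) * V (l₀.succAbove j) i)
                - a k l₀ * t l₀ * ∑ j : Fin m, t (l₀.succAbove j) * V (l₀.succAbove j) i := by
            rw [Finset.mul_sum, ← Finset.sum_sub_distrib]
            refine Finset.sum_congr rfl fun j _ => ?_
            ring
          rw [h4]
          linear_combination h1 + (a k l₀ * t l₀) * h2 - (a k l₀ * V l₀ i) * ht3
  obtain ⟨m, hm, V, a, J₀, T, hJ₀, hT, hβ⟩ := hdec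
  refine claim m hm V a J₀ T (hJ₀.trans ?_) hT hβ
  apply mul_le_mul_of_nonneg_right _ hNr
  have : 0 ≤ ((r₀ : ℝ) - m) * δ := mul_nonneg (by have := hm.le; simp only [sub_nonneg]; exact_mod_cast this) hδ.le
  linarith

/-- **(F) PROVED**: every frame ⊗ own-junta ⊗ linear-common-junta decomposable affine strategy (frame dimension `< r₀`, NO regularity assumed)
loses a constant fraction on the odd class. -/
theorem affFrameLoss : AffFrameLoss := frameRegularization affFrameLossReg


end AffBells27

end Summit.QuantumAdvantage.AdviceFreeQNC0
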